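import Mathlib
import HarnessLib

/-!
# Ring 2 transport — commutants under base change (linear algebra for node 44, converse half; part 1 of 3)

research route conditional on HC_CM; not a corollary; Q11.4-sentence-2 already refuted in dim ≥ 3.

Cell `pub-hodge-ring2`, seat `transport`, gen 51; helper file (pure algebra, no Hodge theory, no open hypothesis).
For fields `F ⊆ K` and a finite-dimensional `F`-space `V`:

* `Commutant.mem_span_baseChange_centralizer` — BASE CHANGE OF COMMUTANTS: a `K`-endomorphism of `K ⊗_F V` commuting
  with the base changes of a set `T ⊆ End_F V` is a `K`-combination of base changes of elements of the commutant of `T`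
  (`C_K(T_K) = C_F(T) ⊗ K`; coordinates in an `F`-basis of `K`, §1 on matrices).
* `Commutant.mem_of_baseChange_mem_span` — DESCENT: `y_K ∈ K · M_K ⇒ y ∈ M` for an `F`-subspace `M ⊆ End_F V`
  (an `F`-linear retraction `K → F` applied entrywise).
* `Commutant.eq_zero_of_isNilpotent_of_forall_commute` — a central nilpotent element of a semisimple ring is `0`.

Used by `Ring2TransportCMTypeOfCommutativeMumfordTate` (part 3: Deligne I Prop. 5.1 `⇒` modulo the residual R).
References: Deligne, LNM 900 (1982) I §5, proof of Prop. 5.1 ("`E ⊗ ℚ̄ ⊇ G` … the bicommutant `E''` equals `E`").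
-/

set_option linter.dupNamespace false

noncomputable section

namespace Summit.HodgeConjecture.HodgeConjecture.Ring2Transport

namespace Commutant

open scoped TensorProduct

/-! ## §1 Matrices: base change of commutants and descent along a field extension `F ⊆ K` -/

section Matrix

variable {F K : Type*} [Field F] [Field K] [Algebra F K] {ι : Type*} [Fintype ι]

/-- Entrywise, an `F`-linear `L : K → F` takes `M · t_K` to `L(M) · t` (`t_K = t` with entries in `K`). [folklore] -/
theorem map_mul_map_algebraMap (L : K →ₗ[F] F) (M : Matrix ι ι K) (t : Matrix ι ι F) :
    (M * t.map (algebraMap F K)).map L = M.map L * t := by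
  ext p q
  simp only [Matrix.map_apply, Matrix.mul_apply, map_sum]
  refine Finset.sum_congr rfl fun r _ => ?_
  rw [mul_comm, ← Algebra.smul_def, map_smul, smul_eq_mul, mul_comm]

/-- Entrywise, an `F`-linear `L : K → F` takes `t_K · M` to `t · L(M)`. [folklore] -/
theorem map_algebraMap_mul_map (L : K →ₗ[F] F) (t : Matrix ι ι F) (M : Matrix ι ι K) :
    (t.map (algebraMap F K) * M).map L = t * M.map L := by
  ext p q
  simp only [Matrix.map_apply, Matrix.mul_apply, map_sum]
  refine Finset.sum_congr rfl fun r _ => ?_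
  rw [← Algebra.smul_def, map_smul, smul_eq_mul]

/-- **Base change of commutants (matrices).** A matrix over `K ⊇ F` commuting with a set `T` of
matrices over `F` is a `K`-linear combination of matrices over `F` commuting with `T`: expand the entries
in an `F`-basis of `K`; each coordinate matrix commutes with `T`. [folklore] -/
theorem matrix_mem_span_centralizer (T : Set (Matrix ι ι F)) (x : Matrix ι ι K)
    (hx : ∀ t ∈ T, x * t.map (algebraMap F K) = t.map (algebraMap F K) * x) :
    x ∈ Submodule.span K ((fun s : Matrix ι ι F => s.map (algebraMap F K)) ''
      {s | ∀ t ∈ T, s * t = t * s}) := by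
  classical
  let b := Module.Free.chooseBasis F K
  -- the coordinate matrices commute with `T`
  have hX : ∀ j, x.map (b.coord j) ∈ {s : Matrix ι ι F | ∀ t ∈ T, s * t = t * s} := by
    intro j t ht
    have h := congrArg (fun M : Matrix ι ι K => M.map (b.coord j)) (hx t ht)
    simpa only [map_mul_map_algebraMap, map_algebraMap_mul_map] using h
  -- reconstruction of `x` from finitely many coordinate matrices
  let J₀ : Finset _ := Finset.univ.biUnion fun pq : ι × ι => (b.repr (x pq.1 pq.2)).support
  have hx_eq : x = ∑ j ∈ J₀, (b j) • (x.map (b.coord j)).map (algebraMap F K) := by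
    ext p q
    simp only [Matrix.sum_apply, Matrix.smul_apply, Matrix.map_apply, Module.Basis.coord_apply,
      smul_eq_mul]
    have hsupp : (b.repr (x p q)).support ⊆ J₀ :=
      fun j hj => Finset.mem_biUnion.2 ⟨(p, q), Finset.mem_univ _, hj⟩
    calc x p q = Finsupp.linearCombination F b (b.repr (x p q)) := (b.linearCombination_repr _).symm
      _ = ∑ j ∈ J₀, (b.repr (x p q) j) • b j := by
          rw [Finsupp.linearCombination_apply]
          exact Finsupp.sum_of_support_subset _ hsupp _ (fun j _ => zero_smul _ _)
      _ = ∑ j ∈ J₀, b j * algebraMap F K (b.repr (x p q) j) := by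
          refine Finset.sum_congr rfl fun j _ => ?_
          rw [Algebra.smul_def, mul_comm]
  rw [hx_eq]
  exact Submodule.sum_mem _ fun j _ =>
    Submodule.smul_mem _ _ (Submodule.subset_span ⟨_, hX j, rfl⟩)

omit [Fintype ι] in
/-- **Descent (matrices).** If `y` has entries in `F` and `y_K` is a `K`-linear combination of the
`m_K`, `m` in an `F`-subspace `M`, then `y ∈ M`: apply an `F`-linear retraction `L : K → F` of
`F ⊆ K` entrywise. [folklore] -/
theorem matrix_mem_of_map_mem_span (M : Submodule F (Matrix ι ι F)) (y : Matrix ι ι F)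
    (hy : y.map (algebraMap F K) ∈ Submodule.span K
      ((fun s : Matrix ι ι F => s.map (algebraMap F K)) '' (M : Set (Matrix ι ι F)))) :
    y ∈ M := by
  obtain ⟨L, hL⟩ : ∃ L : K →ₗ[F] F, L.comp (Algebra.linearMap F K) = LinearMap.id :=
    LinearMap.exists_leftInverse_of_injective _ (LinearMap.ker_eq_bot.2 (algebraMap F K).injective)
  have hL1 : ∀ a : F, L (algebraMap F K a) = a := fun a => LinearMap.congr_fun hL a
  have key : ∀ w ∈ Submodule.span K
      ((fun s : Matrix ι ι F => s.map (algebraMap F K)) '' (M : Set (Matrix ι ι F))),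
      ∀ a : K, (a • w).map L ∈ M := by
    intro w hw
    refine Submodule.span_induction ?_ ?_ ?_ ?_ hw
    · rintro _ ⟨s, hs, rfl⟩ a
      have : (a • s.map (algebraMap F K)).map L = L a • s := by
        ext p q
        simp only [Matrix.map_apply, Matrix.smul_apply, smul_eq_mul]
        rw [mul_comm, ← Algebra.smul_def, map_smul, smul_eq_mul, mul_comm]
      rw [this]
      exact M.smul_mem _ hs
    · intro a
      rw [smul_zero, Matrix.map_zero _ (map_zero L)]
      exact M.zero_mem
    · intro w w' _ _ hw hw' a
      rw [smul_add, Matrix.map_add _ (map_add L)]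
      exact M.add_mem (hw a) (hw' a)
    · intro c w _ hw a
      rw [smul_smul]
      exact hw (a * c)
  have h1 := key _ hy 1
  rwa [one_smul, Matrix.map_map, show (L : K → F) ∘ (algebraMap F K) = id from funext hL1,
    Matrix.map_id] at h1

end Matrix

/-! ## §2 The same for endomorphisms of `V` and of `K ⊗_F V` -/

section End

variable {F K : Type*} [Field F] [Field K] [Algebra F K]
  {V : Type*} [AddCommGroup V] [Module F V] [FiniteDimensional F V]

/-- **Base change of commutants.** A `K`-linear endomorphism of `K ⊗_F V` commuting with the base changes
`t_K` of a set `T` of `F`-linear endomorphisms of `V` is a `K`-linear combination of base changes of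
endomorphisms of `V` commuting with `T` (matrices in a basis of `V`: `matrix_mem_span_centralizer`). [folklore] -/
theorem mem_span_baseChange_centralizer (T : Set (Module.End F V)) (x : Module.End K (K ⊗[F] V))
    (hx : ∀ t ∈ T, x * t.baseChange K = t.baseChange K * x) :
    x ∈ Submodule.span K ((fun s : Module.End F V => s.baseChange K) ''
      {s | ∀ t ∈ T, s * t = t * s}) := by
  classical
  let b := Module.finBasis F V
  let bK := Algebra.TensorProduct.basis K b
  let φ := LinearMap.toMatrix b b
  let Φ := LinearMap.toMatrix bK bK
  have hΦbc : ∀ s : Module.End F V, Φ (s.baseChange K) = (φ s).map (algebraMap F K) :=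
    fun s => LinearMap.toMatrix_baseChange K s b b
  -- the matrix of `x` commutes with the matrices of `T`
  have hx' : ∀ t' ∈ φ '' T, Φ x * t'.map (algebraMap F K) = t'.map (algebraMap F K) * Φ x := by
    rintro _ ⟨t, ht, rfl⟩
    rw [← hΦbc, ← LinearMap.toMatrix_mul, ← LinearMap.toMatrix_mul, hx t ht]
  have hmem := matrix_mem_span_centralizer (φ '' T) (Φ x) hx'
  -- transport back along `Φ⁻¹`
  have hx_eq : x = Φ.symm (Φ x) := (Φ.symm_apply_apply x).symm
  rw [hx_eq, ← LinearEquiv.coe_coe, ← Submodule.mem_comap]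
  refine Submodule.span_le.2 ?_ hmem
  rintro _ ⟨s', hs', rfl⟩
  rw [SetLike.mem_coe, Submodule.mem_comap, LinearEquiv.coe_coe]
  refine Submodule.subset_span ⟨φ.symm s', ?_, ?_⟩
  · intro t ht
    apply φ.injective
    rw [LinearMap.toMatrix_mul, LinearMap.toMatrix_mul, LinearEquiv.apply_symm_apply]
    exact hs' (φ t) ⟨t, ht, rfl⟩
  · show (φ.symm s').baseChange K = Φ.symm (s'.map (algebraMap F K))
    rw [LinearEquiv.eq_symm_apply, hΦbc, LinearEquiv.apply_symm_apply]

/-- **Descent.** An `F`-linear endomorphism of `V` whose base change is a `K`-linear combination of base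
changes of members of an `F`-subspace `M ⊆ End_F V` lies in `M` (`matrix_mem_of_map_mem_span`). [folklore] -/
theorem mem_of_baseChange_mem_span (M : Submodule F (Module.End F V)) (y : Module.End F V)
    (hy : y.baseChange K ∈ Submodule.span K
      ((fun s : Module.End F V => s.baseChange K) '' (M : Set (Module.End F V)))) : y ∈ M := by
  classical
  let b := Module.finBasis F V
  let bK := Algebra.TensorProduct.basis K b
  let φ := LinearMap.toMatrix b b
  let Φ := LinearMap.toMatrix bK bK
  have hΦbc : ∀ s : Module.End F V, Φ (s.baseChange K) = (φ s).map (algebraMap F K) :=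
    fun s => LinearMap.toMatrix_baseChange K s b b
  have h1 : (φ y).map (algebraMap F K) ∈ Submodule.span K
      ((fun s : Matrix _ _ F => s.map (algebraMap F K)) ''
        (↑(M.map φ.toLinearMap) :
          Set (Matrix (Fin (Module.finrank F V)) (Fin (Module.finrank F V)) F))) := by
    rw [← hΦbc]
    have h2 : Φ (y.baseChange K) ∈ (Submodule.span K
        ((fun s : Module.End F V => s.baseChange K) '' (M : Set (Module.End F V)))).map
          (Φ : Module.End K (K ⊗[F] V) →ₗ[K] _) := Submodule.mem_map_of_mem hy
    rw [Submodule.map_span] at h2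
    refine Submodule.span_mono ?_ h2
    rintro _ ⟨_, ⟨s, hs, rfl⟩, rfl⟩
    exact ⟨φ s, ⟨s, hs, rfl⟩, (hΦbc s).symm⟩
  have h3 := matrix_mem_of_map_mem_span _ _ h1
  rw [Submodule.mem_map] at h3
  obtain ⟨y', hy', hyy'⟩ := h3
  rwa [φ.injective hyy'] at hy'

end End

/-! ## §3 A central nilpotent element of a semisimple ring vanishes -/

/-- In a semisimple ring a central nilpotent element is zero: the left ideal `R z` has a complement,
`1 = a z + f`, whence `z = a z · z` and `z = (a z)ⁿ z = aⁿ zⁿ z = 0`. [folklore] -/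
theorem eq_zero_of_isNilpotent_of_forall_commute {R : Type*} [Ring R] [IsSemisimpleRing R] {z : R}
    (hz : ∀ r : R, z * r = r * z) (hn : IsNilpotent z) : z = 0 := by
  obtain ⟨J, hJ⟩ := exists_isCompl (Submodule.span R ({z} : Set R))
  have h1 : (1 : R) ∈ Submodule.span R ({z} : Set R) ⊔ J := by
    rw [hJ.sup_eq_top]; exact Submodule.mem_top
  obtain ⟨e, he, f, hf, hef⟩ := Submodule.mem_sup.1 h1
  obtain ⟨a, rfl⟩ := Submodule.mem_span_singleton.1 he
  -- `z f ∈ R z ⊓ J = 0`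
  have hzf : z * f = 0 := by
    have hI : z * f ∈ Submodule.span R ({z} : Set R) := by
      have hf' : f = 1 - a • z := eq_sub_of_add_eq' hef
      have : z * f = z - (z * a) • z := by
        rw [hf', mul_sub, mul_one, smul_eq_mul, smul_eq_mul, mul_assoc]
      rw [this]
      exact Submodule.sub_mem _ (Submodule.mem_span_singleton_self z) (Submodule.smul_mem _ _
        (Submodule.mem_span_singleton_self z))
    have hJ' : z * f ∈ J := by
      have := J.smul_mem z hf
      rwa [smul_eq_mul] at this
    have hbot := hJ.inf_eq_bot
    have : z * f ∈ Submodule.span R ({z} : Set R) ⊓ J := Submodule.mem_inf.2 ⟨hI, hJ'⟩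
    rw [hbot] at this
    exact (Submodule.mem_bot R).1 this
  have hc : z = (a * z) * z := by
    calc z = z * 1 := (mul_one z).symm
      _ = z * (a • z + f) := by rw [hef]
      _ = z * (a * z) := by rw [smul_eq_mul, mul_add, hzf, add_zero]
      _ = (a * z) * z := hz (a * z)
  have hpow : ∀ n : ℕ, z = (a * z) ^ n * z := by
    intro n
    induction n with
    | zero => rw [pow_zero, one_mul]
    | succ n ih => rw [pow_succ, mul_assoc, ← hc]; exact ih
  obtain ⟨k, hk⟩ := hn
  have hcomm : Commute a z := (hz a).symm
  rw [hpow k, hcomm.mul_pow, hk, mul_zero, zero_mul]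


end Commutant

end Summit.HodgeConjecture.HodgeConjecture.Ring2Transport

end
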